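import Summits.Ventures.PercRepro2.CaseOneStarCertT1
import Summits.Ventures.PercRepro2.CaseOneGadgetUWA1BBlockII0
import Summits.Ventures.PercRepro2.CaseOneGadgetUWA1BBlockII1
import Summits.Ventures.PercRepro2.CaseOneGadgetUWA1BBlockII2
import Summits.Ventures.PercRepro2.CaseOneGadgetUWA1BBlockII3
import Summits.Ventures.PercRepro2.CaseOneGadgetUWA1BBlockII4
import Summits.Ventures.PercRepro2.CaseOneGadgetUWA1BBlockII5
import Summits.Ventures.PercRepro2.CaseOneGadgetUWA1BBlockII6
import Summits.Ventures.PercRepro2.CaseOneGadgetUWA1BBlockII7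
import Summits.Ventures.PercRepro2.CaseOneGadgetUWA1BBlockII8
import Summits.Ventures.PercRepro2.CaseOneGadgetUWA1BBlockII9
import Summits.Ventures.PercRepro2.CaseOneGadgetUWA1BBlockII10
import Summits.Ventures.PercRepro2.CaseOneGadgetUWA1BBlockII11
import Summits.Ventures.PercRepro2.CaseOneGadgetUWA1BBlockII12
import Summits.Ventures.PercRepro2.CaseOneGadgetUWA1BBlockII13
import Summits.Ventures.PercRepro2.CaseOneGadgetUWA1BBlockII14
import Summits.Ventures.PercRepro2.CaseOneStarFactsB

/-!
# The gadget `u ~ {w, a₁, b}`, `w ~ {u, a₂, o}` (uwa1b): the cell certificates of `iiAB5` (part 38a)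
(blind cell PercRepro2, p1 g34; the fourth gadget anchor of the six-form calculus — all six forms of the uwa1b gadget
as plain SFacts-cone certificate chains, generated by mining/p1/g34/uwa1b/genu.py = p1 g33's gent_uwa1.py / g25's
geno.py re-targeted; P1-G33 §6–§6″, P1-G34)

Each `eBABII ijk kl` is a nonnegative combination of `(pairwise atom) × (cell)` and cubic cell monomials — or, for the degree-4 ones, `M × eBABII ijk kl` (`M = Σ cᵢ` the total cell mass) is a nonnegative combination of `(atom) × (cell) × (cell)` and quartic cell monomials, then `SFacts.nonneg_of_sum_mul` (`CaseOneStarCertT1`) — exact LP certificates (kit j318477, every certificate re-verified exactly; data/p1/g33/gcerts_ii_uwa1b.json, form `ii`), here as exact `linear_combination`s over `SFacts` (the rational coefficients cleared by their common denominator). -/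

namespace Summit.Ventures.PercRepro2

namespace CaseOne

section CertABII38a
variable {R : Type*} [Field R] [LinearOrder R] [IsStrictOrderedRing R]

set_option maxHeartbeats 0 in
/-- `eBABII31321 ≥ 0`: the combination is identically zero (`ring`). -/
lemma eBABII31321_nonneg (m : SCells R) (_hf : SFactsB m) : 0 ≤ eBABII31321 m := by
  have h : eBABII31321 m = 0 := by
    unfold eBABII31321 cBABII00121 cBABII00221 cBABII01021 cBABII01121 cBABII01221 cBABII01321 cBABII10021 cBABII10121 cBABII10221 cBABII10321 cBABII11021 cBABII11121 cBABII11221 cBABII11321 cBABII20021 cBABII20121 cBABII20221 cBABII20321 cBABII21021 cBABII21121 cBABII21221 cBABII21321 cBABII30121 cBABII30221 cBABII30321 cBABII31021 cBABII31121 cBABII31221 cBABII31321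
    ring
  linarith [h]

set_option maxHeartbeats 0 in
/-- `eBABII31322 ≥ 0`: the combination is identically zero (`ring`). -/
lemma eBABII31322_nonneg (m : SCells R) (_hf : SFactsB m) : 0 ≤ eBABII31322 m := by
  have h : eBABII31322 m = 0 := by
    unfold eBABII31322 cBABII00122 cBABII00222 cBABII01022 cBABII01122 cBABII01222 cBABII01322 cBABII10022 cBABII10122 cBABII10222 cBABII10322 cBABII11022 cBABII11122 cBABII11222 cBABII11322 cBABII20022 cBABII20122 cBABII20222 cBABII20322 cBABII21022 cBABII21122 cBABII21222 cBABII21322 cBABII30122 cBABII30222 cBABII30322 cBABII31022 cBABII31122 cBABII31222 cBABII31322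
    ring
  linarith [h]

end CertABII38a

end CaseOne

end Summit.Ventures.PercRepro2
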